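import Summits.QuantumFields.YangMills.Theorems.BalabanUVNodesN19TargetAtRecord13Sep
import Summits.QuantumFields.YangMills.Theorems.BalabanUVNodesN19TargetAtHomes13SepOnVacuumMGF
import Summits.QuantumFields.YangMills.Theses.BalabanUVNodes

/-!
# BalabanUVNodes ∕ N19 (NE7 proper) — the LIVE route crux K3⁗ `SpineGivenEndpointR13Sep` (stmt-QuantumFields-20292, route rev 19) READ IN N19's CURRENCY: node U5's
# DECL target `T4ApexVariance.MatchingUnder` at every guarded admissible SEPARATED-RANGE Stage-13 datum of record (`N = 2`) — the ⁗ twin of module 9 §1 (`…N19TargetK3R12Reading`,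
# p467546 ∕ v1.2 p486289) over module 23⁗ (`…N19TargetAtRecord13Sep`, p505491)

Cell `pub-ymgap` (HUMAN RULING D-0062, Track A), R134 ACCELERATION seat `pub-ymgap-dag-n19-d` (strategy s2), gen 7, module 29.  This file imports the route file BECAUSE its theorems
carry the route decl `Summit.QuantumFields.YangMills.Theses.BalabanUVNodes.SpineGivenEndpointR13Sep` in their TYPE (director LINE №103 (1) rule; nothing imports this file); everything
else of the N19 knit lives in the Theses-free modules.  Filed `--kind proof --supports stmt-QuantumFields-20292 --as helper` (plan g67 KEY-18; dag-lead WORDS-140; director-ym №140 —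
«until vetted 4∕4 the route shows READY: NO for claims — file `--as helper`»).  COUNT-NEUTRAL.  NO theorem below has the bare item as its type (all are `… → SpineGivenEndpointR13Sep` or
`↔`); nothing is claimed.
* §1 the reading: K3⁗ ⟺ «for every family, every Stage-13 tuple θ with separated-range provisos, print's partition of unity and non-degenerate present slots (`θ.ZtUnity F 2 ∧
  θ.SlotsNondegenerate₁₃ F 2`), admissible: `MatchingUnder (Node00.datumOfRecord₁₃Sep F 2 θ h) END`» (module 23⁗ `forall_guarded_matchingUnder_datumOfRecord₁₃Sep_iff` at the guard of record
  + the item's displayed `(B) → END →` prefix absorbed — B5-under-END carries its own; ref-B READ-485's advisory on the duplicated prefix stands); K3⁗ from N19's target at every Sep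
  RECORD (worlds eliminated); and ★ K3⁗ from the CHILDREN's θ-INDEXED FACES ON THE SAME TUPLE — N20 `RelWeightBound` ∕ N21 `ShellWeightBound` at a spine reading `cr`, K4's six rates at a
  rate reading `rr`, the N19′ edge `KeyedCoreEdge cr rr` and the keyed extraction clause, i.e. plan g67's K3 skeleton shapes unbundled (module 23⁗ `matchingUnder_at_record₁₃Sep_of_keyedFaces`),
  and the same with the edge PRODUCED by a source-split reading (module 23⁗ `coreEdge_keyed₁₃Sep_of_sourceSplitReading`, dag-n19-e's (V)+(I) currency).
* §2 (the item from the stubs at the Sep HOMES `SRec₁₃Sep(On)` ∕ `RRec₁₃Sep(On)` and a source-split ∕ vacuum-MGF reading — modules 23b⁗∕24⁗∕24b⁗) follows APPEND-ONLY when the spine-carrier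
  Sep home is in the tree (n27-c g7 l.17100 BLOCKER: declarer pending).

HONEST FRAMING.  Bookkeeping: `↔`∕`→` re-readings of the item in node U5's letters; every stub, reading and edge is a HYPOTHESIS (0∕1 at the record today); (V)+(I) NOT PRINTED; nothing
of Bałaban's is asserted or instantiated; NE7 ∕ NE7b ∕ NE7c NOT PRINTED for d = 4, NOT PROVED; NO node is discharged; K3⁗ NOT claimed (not vetted 4∕4 either); no Sep inhabitant claimed
(K0⁗ `Record13SepInhabited` stmt-QuantumFields-20289 open); counts UNMOVED (typed 28∕28 · discharged 5∕27, A 5∕28); one finite four-torus programme at fixed `ε = L^{−K}` — NOT ℝ⁴, NOT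
infinite volume, NOT OS, NOT a mass gap, NOT Clay.  0 `def`, 0 `sorry`; no decl below carries a cite tag (bookkeeping [folklore]).
-/

open Finset

namespace Summit.QuantumFields.YangMills.BalabanUVNodes.N19TargetK3R13SepReading

open Literature.MathematicalPhysics.QuantumFieldTheory.Balaban1983to89
open Literature.MathematicalPhysics.QuantumFieldTheory.Balaban1983to89.T4Continuum
open T4WeightBudget (RelWeightBound)
open T4IndicatorShell (ShellWeightBound)
open T4ContinuumYM4Torus (ForSmallCouplings)
open T4ApexVariance (MatchingUnder)
open Summit.QuantumFields.BalabanUV.T4Continuum.Spine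
open Summit.QuantumFields.YangMills.Theses.BalabanUVNodes (SpineGivenEndpointR13Sep)
open Summit.QuantumFields.YangMills.BalabanUVNodes.N19TargetAtRecord13Sep (hybridNE7Under_datumOfRecord₁₃Sep_iff_matchingUnder
  forall_record₁₃Sep_matchingUnder_iff_forall_datumOfRecord₁₃Sep matchingUnder_at_record₁₃Sep_of_keyedFaces coreEdge_keyed₁₃Sep_of_sourceSplitReading)
open YMDAG.UVSplit
open Node00 (Stage13Params datumOfRecord₁₃Sep IsRecordOfRecord₁₃CSep)

/-! ## §1 The reading of K3⁗ in node U5's currency, and K3⁗ from the children's θ-indexed faces on the same tuple -/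

/-- **K3⁗ ⟹ N19's TARGET AT EVERY GUARDED ADMISSIBLE SEPARATED-RANGE STAGE-13 DATUM** [bookkeeping]: from `SpineGivenEndpointR13Sep`, at every `θ` with provisos `h`, the guard
`θ.ZtUnity F 2 ∧ θ.SlotsNondegenerate₁₃ F 2` and `θ.Admissible F 2`: `MatchingUnder (datumOfRecord₁₃Sep F 2 θ h) END` (the item's displayed `(B) → END →` prefix is fed B5-under-END's own
antecedents; then the degenerate expansion at the datum, module 23⁗). [folklore] -/
theorem matchingUnder_datumOfRecord₁₃Sep_of_spineGivenEndpointR13Sep (hK : SpineGivenEndpointR13Sep) (F : T4Family) (θ : Stage13Params F 2) (h : θ.Provisos₁₃Sep F 2)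
    (hG : θ.ZtUnity F 2 ∧ θ.SlotsNondegenerate₁₃ F 2) (hθ : θ.Admissible F 2) :
    MatchingUnder (datumOfRecord₁₃Sep F 2 θ h) (DagBinding.EndpointExistence (datumOfRecord₁₃Sep F 2 θ h).C.toB12) :=
  (hybridNE7Under_datumOfRecord₁₃Sep_iff_matchingUnder θ h _).mp fun hB hE => hK F θ h hG hθ hB hE hB hE

/-- **N19's TARGET AT EVERY GUARDED ADMISSIBLE SEPARATED-RANGE STAGE-13 DATUM ⟹ K3⁗** [bookkeeping] (the displayed (B)∕END hypotheses are discarded — B5 under END carries its own). [folklore] -/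
theorem spineGivenEndpointR13Sep_of_forall_guarded_matchingUnder
    (h : ∀ (F : T4Family) (θ : Stage13Params F 2) (hP : θ.Provisos₁₃Sep F 2), θ.ZtUnity F 2 ∧ θ.SlotsNondegenerate₁₃ F 2 → θ.Admissible F 2 →
      MatchingUnder (datumOfRecord₁₃Sep F 2 θ hP) (DagBinding.EndpointExistence (datumOfRecord₁₃Sep F 2 θ hP).C.toB12)) :
    SpineGivenEndpointR13Sep :=
  fun F θ hP hG hθ _ _ => (hybridNE7Under_datumOfRecord₁₃Sep_iff_matchingUnder θ hP _).mpr (h F θ hP hG hθ)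

/-- **THE READING: K3⁗ `SpineGivenEndpointR13Sep` ⟺ N19's DECL TARGET AT EVERY GUARDED ADMISSIBLE SEPARATED-RANGE STAGE-13 DATUM OF RECORD** [bookkeeping] — at `N = 2`, for every
family, every Stage-13 tuple `θ` with provisos `Provisos₁₃Sep`, print's partition of unity and non-degenerate present slots, admissible: `T4ApexVariance.MatchingUnder
(Node00.datumOfRecord₁₃Sep F 2 θ h) END` (for all small-coupling tuned runs and every loop string, the dressed partition functions of the two runs match modulo `t`-independent constants with
a summable remainder).  Module 23⁗'s `forall_guarded_matchingUnder_datumOfRecord₁₃Sep_iff` at the guard of record `Node00.unityNondeg₁₃ 2`, the item's (B)∕END prefix absorbed. [folklore] -/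
theorem spineGivenEndpointR13Sep_iff_forall_guarded_matchingUnder :
    SpineGivenEndpointR13Sep ↔ ∀ (F : T4Family) (θ : Stage13Params F 2) (h : θ.Provisos₁₃Sep F 2), θ.ZtUnity F 2 ∧ θ.SlotsNondegenerate₁₃ F 2 → θ.Admissible F 2 →
      MatchingUnder (datumOfRecord₁₃Sep F 2 θ h) (DagBinding.EndpointExistence (datumOfRecord₁₃Sep F 2 θ h).C.toB12) :=
  ⟨matchingUnder_datumOfRecord₁₃Sep_of_spineGivenEndpointR13Sep, spineGivenEndpointR13Sep_of_forall_guarded_matchingUnder⟩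

/-- **N19's TARGET AT EVERY SEPARATED-RANGE STAGE-13 RECORD GIVES K3⁗** [bookkeeping]: «`MatchingUnder D END` at every `Node00.IsRecordOfRecord₁₃CSep F 2 D w`» — the conclusion shape of
module 23⁗'s closers `matchingUnder_at_record₁₃Sep_of_spineRates ∕ _of_rateStubs(_tail) ∕ _of_termBudgetReading ∕ _of_keyedFaces ∕ …` at `N = 2` — implies `SpineGivenEndpointR13Sep` (worlds
eliminated by (K2) = n27-c `exists_world_of_keyed₁₃Sep`, module 23⁗ `forall_record₁₃Sep_matchingUnder_iff_forall_datumOfRecord₁₃Sep`; the guard only weakens). [folklore] -/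
theorem spineGivenEndpointR13Sep_of_forall_record₁₃Sep_matchingUnder
    (h : ∀ (F : T4Family) (D : Datum F 2) (w : DagBinding.WorldP), IsRecordOfRecord₁₃CSep F 2 D w → MatchingUnder D (DagBinding.EndpointExistence D.C.toB12)) :
    SpineGivenEndpointR13Sep :=
  spineGivenEndpointR13Sep_of_forall_guarded_matchingUnder fun F θ hP _ hθ => forall_record₁₃Sep_matchingUnder_iff_forall_datumOfRecord₁₃Sep.mp h F θ hP hθ

section KeyedFaces

variable (cr : ∀ {F : T4Family} (θ : Stage13Params F 2), θ.Provisos₁₃Sep F 2 → (ℕ → ℝ) → List (ULoop F) → SpineCarriers)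
  (rr : ∀ {F : T4Family} (θ : Stage13Params F 2), θ.Provisos₁₃Sep F 2 → (ℕ → ℝ) → List (ULoop F) → RateCarriers 2)

/-- **★ K3⁗ FROM THE CHILDREN's θ-INDEXED ESTIMATES ON THE SAME SEPARATED-RANGE TUPLE — plan g67's K3 skeleton shapes, unbundled** [bookkeeping] (module 23⁗
`matchingUnder_at_record₁₃Sep_of_keyedFaces` at `N = 2`, then `spineGivenEndpointR13Sep_of_forall_record₁₃Sep_matchingUnder`): for readings `cr` (spine carriers) and `rr` (rate carriers) off the
Sep tuples — N20 `RelWeightBound` and N21 `ShellWeightBound` at `cr θ h g₀ os` (`KeyedRelWeight` ∕ `KeyedShellWeight`), K4's six rates jointly at `rr θ h g₀ os` on `datumOfRecord₁₃Sep F 2 θ h`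
(`KeyedRates`), the SAME-TUPLE N19′ edge (`KeyedCoreEdge cr rr`: the rates ⇒ SOME summable `δ` with `Spine.NE7.Core` on the shell-free cores), and the keyed extraction clause (`KeyedExtraction`:
positivity + E1∕E2 under (B), END, small tuned couplings), each for EVERY admissible θ with Sep provisos ⇒ `SpineGivenEndpointR13Sep`.  Every face a HYPOTHESIS (0∕1); this is the composer of
the skeleton's `stub_expansion13`-conjuncts with the rates displayed rather than ∃-quantified. [folklore] -/
theorem spineGivenEndpointR13Sep_of_keyedFaces
    (h20 : ∀ (F : T4Family) (θ : Stage13Params F 2) (hP : θ.Provisos₁₃Sep F 2), θ.Admissible F 2 → ∀ (g₀ : ℕ → ℝ) (os : List (ULoop F)),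
      RelWeightBound (cr θ hP g₀ os).l₀ (cr θ hP g₀ os).T (cr θ hP g₀ os).A (cr θ hP g₀ os).B (cr θ hP g₀ os).Bad (cr θ hP g₀ os).W)
    (h21 : ∀ (F : T4Family) (θ : Stage13Params F 2) (hP : θ.Provisos₁₃Sep F 2), θ.Admissible F 2 → ∀ (g₀ : ℕ → ℝ) (os : List (ULoop F)),
      ShellWeightBound (cr θ hP g₀ os).l₀ (cr θ hP g₀ os).T (cr θ hP g₀ os).A (cr θ hP g₀ os).B (cr θ hP g₀ os).shA (cr θ hP g₀ os).shB (cr θ hP g₀ os).Wsh)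
    (hrates : ∀ (F : T4Family) (θ : Stage13Params F 2) (hP : θ.Provisos₁₃Sep F 2), θ.Admissible F 2 → ∀ (g₀ : ℕ → ℝ) (os : List (ULoop F)),
      RatesAt (datumOfRecord₁₃Sep F 2 θ hP) (rr θ hP g₀ os))
    (h19 : ∀ (F : T4Family) (θ : Stage13Params F 2) (hP : θ.Provisos₁₃Sep F 2), θ.Admissible F 2 → ∀ (g₀ : ℕ → ℝ) (os : List (ULoop F)),
      RatesAt (datumOfRecord₁₃Sep F 2 θ hP) (rr θ hP g₀ os) → letI := (cr θ hP g₀ os).dec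
        ∃ δ : ℕ → ℝ, NE7.Core (cr θ hP g₀ os).l₀ (cr θ hP g₀ os).vol (cr θ hP g₀ os).T (cr θ hP g₀ os).Bad
          (fun K t τ => (cr θ hP g₀ os).A K t τ - (cr θ hP g₀ os).shA K t τ) (fun K t τ => (cr θ hP g₀ os).B K t τ - (cr θ hP g₀ os).shB K t τ) δ ∧ Summable δ)
    (hx : ∀ (F : T4Family) (θ : Stage13Params F 2) (hP : θ.Provisos₁₃Sep F 2), θ.Admissible F 2 →
      B16.EndStatementBPrinted (datumOfRecord₁₃Sep F 2 θ hP).C → DagBinding.EndpointExistence (datumOfRecord₁₃Sep F 2 θ hP).C.toB12 →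
        ForSmallCouplings (datumOfRecord₁₃Sep F 2 θ hP) fun g₀ => ∀ os : List (ULoop F),
          0 < (cr θ hP g₀ os).l₀ ∧ 0 < (cr θ hP g₀ os).vol ∧
          (∀ (K : ℕ) (t : ℝ), |t| ≤ (cr θ hP g₀ os).l₀ →
            T4GenFunBounds.schemeZ ((datumOfRecord₁₃Sep F 2 θ hP).scheme g₀) os ((cr θ hP g₀ os).K₀ + K) t = ∑ τ ∈ (cr θ hP g₀ os).T K, (cr θ hP g₀ os).A K t τ) ∧
          (∀ (K : ℕ) (t : ℝ), |t| ≤ (cr θ hP g₀ os).l₀ →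
            T4GenFunBounds.schemeZ ((datumOfRecord₁₃Sep F 2 θ hP).scheme g₀) os ((cr θ hP g₀ os).K₀ + K + 1) t =
              ∑ τ ∈ (cr θ hP g₀ os).T K, (cr θ hP g₀ os).B K t τ)) :
    SpineGivenEndpointR13Sep :=
  spineGivenEndpointR13Sep_of_forall_record₁₃Sep_matchingUnder fun _ _ _ hR =>
    matchingUnder_at_record₁₃Sep_of_keyedFaces cr rr h20 h21 hrates h19 hx hR

/-- **… WITH THE N19′ EDGE PRODUCED BY A SOURCE-SPLIT READING** [bookkeeping] (module 23⁗ `coreEdge_keyed₁₃Sep_of_sourceSplitReading`, dag-n19-e's located (V)+(I) currency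
`N19SourceSplit.core_of_vacuum_of_insertion`): the same with `h19` replaced by «at every admissible θ with Sep provisos, every `g₀`, `os`, GIVEN the rates at `rr θ hP g₀ os`: positive
shell-free cores on the good classes + (V) a class-uniform VACUUM matching + (I) a per-class SOURCE-RESPONSE matching with SUMMABLE `δ⁰`, `δ¹`».  What an NE7 prover exhibits at the
separated-range Stage-13 objects toward the live crux, in the source-split currency; every input a HYPOTHESIS today. [folklore] -/
theorem spineGivenEndpointR13Sep_of_keyedFaces_sourceSplit
    (h20 : ∀ (F : T4Family) (θ : Stage13Params F 2) (hP : θ.Provisos₁₃Sep F 2), θ.Admissible F 2 → ∀ (g₀ : ℕ → ℝ) (os : List (ULoop F)),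
      RelWeightBound (cr θ hP g₀ os).l₀ (cr θ hP g₀ os).T (cr θ hP g₀ os).A (cr θ hP g₀ os).B (cr θ hP g₀ os).Bad (cr θ hP g₀ os).W)
    (h21 : ∀ (F : T4Family) (θ : Stage13Params F 2) (hP : θ.Provisos₁₃Sep F 2), θ.Admissible F 2 → ∀ (g₀ : ℕ → ℝ) (os : List (ULoop F)),
      ShellWeightBound (cr θ hP g₀ os).l₀ (cr θ hP g₀ os).T (cr θ hP g₀ os).A (cr θ hP g₀ os).B (cr θ hP g₀ os).shA (cr θ hP g₀ os).shB (cr θ hP g₀ os).Wsh)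
    (hrates : ∀ (F : T4Family) (θ : Stage13Params F 2) (hP : θ.Provisos₁₃Sep F 2), θ.Admissible F 2 → ∀ (g₀ : ℕ → ℝ) (os : List (ULoop F)),
      RatesAt (datumOfRecord₁₃Sep F 2 θ hP) (rr θ hP g₀ os))
    (hread : ∀ (F : T4Family) (θ : Stage13Params F 2) (hP : θ.Provisos₁₃Sep F 2), θ.Admissible F 2 → ∀ (g₀ : ℕ → ℝ) (os : List (ULoop F)),
      RatesAt (datumOfRecord₁₃Sep F 2 θ hP) (rr θ hP g₀ os) → letI := (cr θ hP g₀ os).dec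
      (∀ K t, |t| ≤ (cr θ hP g₀ os).l₀ → ∀ τ ∈ (cr θ hP g₀ os).T K \ (cr θ hP g₀ os).Bad K t,
        0 < (cr θ hP g₀ os).A K t τ - (cr θ hP g₀ os).shA K t τ ∧ 0 < (cr θ hP g₀ os).B K t τ - (cr θ hP g₀ os).shB K t τ) ∧
      ∃ δ₀ δ₁ : ℕ → ℝ, Summable δ₀ ∧ Summable δ₁ ∧
        (∀ K, ∃ c : ℝ, ∀ t : ℝ, |t| ≤ (cr θ hP g₀ os).l₀ → ∀ τ ∈ (cr θ hP g₀ os).T K \ (cr θ hP g₀ os).Bad K t,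
          |Real.log ((cr θ hP g₀ os).B K 0 τ - (cr θ hP g₀ os).shB K 0 τ) - Real.log ((cr θ hP g₀ os).A K 0 τ - (cr θ hP g₀ os).shA K 0 τ) - c| ≤
            (cr θ hP g₀ os).vol * δ₀ K) ∧
        (∀ K (t : ℝ), |t| ≤ (cr θ hP g₀ os).l₀ → ∀ τ ∈ (cr θ hP g₀ os).T K \ (cr θ hP g₀ os).Bad K t,
          |(Real.log ((cr θ hP g₀ os).B K t τ - (cr θ hP g₀ os).shB K t τ) - Real.log ((cr θ hP g₀ os).A K t τ - (cr θ hP g₀ os).shA K t τ)) -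
              (Real.log ((cr θ hP g₀ os).B K 0 τ - (cr θ hP g₀ os).shB K 0 τ) - Real.log ((cr θ hP g₀ os).A K 0 τ - (cr θ hP g₀ os).shA K 0 τ))| ≤
            (cr θ hP g₀ os).vol * δ₁ K))
    (hx : ∀ (F : T4Family) (θ : Stage13Params F 2) (hP : θ.Provisos₁₃Sep F 2), θ.Admissible F 2 →
      B16.EndStatementBPrinted (datumOfRecord₁₃Sep F 2 θ hP).C → DagBinding.EndpointExistence (datumOfRecord₁₃Sep F 2 θ hP).C.toB12 →
        ForSmallCouplings (datumOfRecord₁₃Sep F 2 θ hP) fun g₀ => ∀ os : List (ULoop F),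
          0 < (cr θ hP g₀ os).l₀ ∧ 0 < (cr θ hP g₀ os).vol ∧
          (∀ (K : ℕ) (t : ℝ), |t| ≤ (cr θ hP g₀ os).l₀ →
            T4GenFunBounds.schemeZ ((datumOfRecord₁₃Sep F 2 θ hP).scheme g₀) os ((cr θ hP g₀ os).K₀ + K) t = ∑ τ ∈ (cr θ hP g₀ os).T K, (cr θ hP g₀ os).A K t τ) ∧
          (∀ (K : ℕ) (t : ℝ), |t| ≤ (cr θ hP g₀ os).l₀ →
            T4GenFunBounds.schemeZ ((datumOfRecord₁₃Sep F 2 θ hP).scheme g₀) os ((cr θ hP g₀ os).K₀ + K + 1) t =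
              ∑ τ ∈ (cr θ hP g₀ os).T K, (cr θ hP g₀ os).B K t τ)) :
    SpineGivenEndpointR13Sep :=
  spineGivenEndpointR13Sep_of_keyedFaces cr rr h20 h21 hrates (coreEdge_keyed₁₃Sep_of_sourceSplitReading (N := 2) cr rr hread) hx

end KeyedFaces

/-! ## §2 (v1.1, append-only — ⁗) The item from the stubs at the GUARD-restricted Stage-13 (separated-range) homes and a SOURCE-SPLIT reading (module 24⁗ by name) -/

section GuardHomes

open Summit.QuantumFields.YangMills.BalabanUVNodes.N19TargetAtHomes13SepOn (matchingUnder_guarded_datumOfRecord₁₃Sep_of_homes₁₃SepOn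
  matchingUnder_guarded_datumOfRecord₁₃Sep_of_homes₁₃SepOn_sourceSplit towerEdge₁₃SepOn_of_insertionDerivReading)

variable (cr : SpineReading₁₃Sep 2) (𝔯 : RateReading₁₃Sep 2)

/-- **K3⁗ FROM THE STUBS AT THE GUARD-RESTRICTED STAGE-13 (Sep) HOMES AND A SOURCE-SPLIT READING** [bookkeeping] (`N = 2`, regime = the item's guard
`θ.ZtUnity F 2 ∧ θ.SlotsNondegenerate₁₃ F 2`): the six in-edges BY NAME at `RRec₁₃SepOn 𝔯 Rg` (`S_N14` · `S_N15` · `S_N16` · `S_N17` · `S_N18` · `S_N22`, each its node's estimate asked ONLY of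
guarded admissible tuples, read at θ), `S_N20` ∕ `S_N21` at `SRec₁₃SepOn cr Rg`, the guarded keyed extraction clause (positivity + E1∕E2 under (B), END, small tuned couplings), and a
SOURCE-SPLIT reading of `cr` at the guarded tuples — given the rates at every run length of `𝔯`: positive shell-free cores on the good classes, (V) a class-uniform VACUUM matching and
(I) a per-class SOURCE-RESPONSE matching of `log (B − shB) − log (A − shA)` with summable `δ⁰`, `δ¹` — ⇒ `SpineGivenEndpointR13Sep` (module 24⁗
`matchingUnder_guarded_datumOfRecord₁₃Sep_of_homes₁₃SepOn_sourceSplit` ∘ `spineGivenEndpointR13Sep_of_forall_guarded_matchingUnder`).  Every input a HYPOTHESIS; (V)∕(I) NOT PRINTED. [folklore] -/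
theorem spineGivenEndpointR13Sep_of_homes₁₃SepOn_sourceSplit
    (h14 : S_N14 (RRec₁₃SepOn 𝔯 fun F θ => θ.ZtUnity F 2 ∧ θ.SlotsNondegenerate₁₃ F 2)) (h15 : S_N15 (RRec₁₃SepOn 𝔯 fun F θ => θ.ZtUnity F 2 ∧ θ.SlotsNondegenerate₁₃ F 2))
    (h16 : S_N16 (RRec₁₃SepOn 𝔯 fun F θ => θ.ZtUnity F 2 ∧ θ.SlotsNondegenerate₁₃ F 2)) (h17 : S_N17 (RRec₁₃SepOn 𝔯 fun F θ => θ.ZtUnity F 2 ∧ θ.SlotsNondegenerate₁₃ F 2))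
    (h18 : S_N18 (RRec₁₃SepOn 𝔯 fun F θ => θ.ZtUnity F 2 ∧ θ.SlotsNondegenerate₁₃ F 2)) (h22 : S_N22 (RRec₁₃SepOn 𝔯 fun F θ => θ.ZtUnity F 2 ∧ θ.SlotsNondegenerate₁₃ F 2))
    (h20 : S_N20 (SRec₁₃SepOn cr fun F θ => θ.ZtUnity F 2 ∧ θ.SlotsNondegenerate₁₃ F 2)) (h21 : S_N21 (SRec₁₃SepOn cr fun F θ => θ.ZtUnity F 2 ∧ θ.SlotsNondegenerate₁₃ F 2))
    (hx : ∀ (F : T4Family) (θ : Stage13Params F 2) (hP : θ.Provisos₁₃Sep F 2), θ.ZtUnity F 2 ∧ θ.SlotsNondegenerate₁₃ F 2 → θ.Admissible F 2 →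
      B16.EndStatementBPrinted (datumOfRecord₁₃Sep F 2 θ hP).C → DagBinding.EndpointExistence (datumOfRecord₁₃Sep F 2 θ hP).C.toB12 →
        T4ContinuumYM4Torus.ForSmallCouplings (datumOfRecord₁₃Sep F 2 θ hP) fun g₀ => ∀ os : List (ULoop F),
          0 < (cr F θ hP g₀ os).l₀ ∧ 0 < (cr F θ hP g₀ os).vol ∧
          (∀ (K : ℕ) (t : ℝ), |t| ≤ (cr F θ hP g₀ os).l₀ →
            T4GenFunBounds.schemeZ ((datumOfRecord₁₃Sep F 2 θ hP).scheme g₀) os ((cr F θ hP g₀ os).K₀ + K) t =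
              ∑ τ ∈ (cr F θ hP g₀ os).T K, (cr F θ hP g₀ os).A K t τ) ∧
          (∀ (K : ℕ) (t : ℝ), |t| ≤ (cr F θ hP g₀ os).l₀ →
            T4GenFunBounds.schemeZ ((datumOfRecord₁₃Sep F 2 θ hP).scheme g₀) os ((cr F θ hP g₀ os).K₀ + K + 1) t =
              ∑ τ ∈ (cr F θ hP g₀ os).T K, (cr F θ hP g₀ os).B K t τ))
    (hread : ∀ (F : T4Family) (θ : Stage13Params F 2) (hP : θ.Provisos₁₃Sep F 2), θ.ZtUnity F 2 ∧ θ.SlotsNondegenerate₁₃ F 2 → θ.Admissible F 2 →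
      ∀ (g₀ : ℕ → ℝ) (os : List (ULoop F)),
      (∀ k : ℕ, RatesAt (datumOfRecord₁₃Sep F 2 θ hP) (rateCarriersOfRecord₁₃Sep 𝔯 F θ hP g₀ os k)) → letI := (cr F θ hP g₀ os).dec
      (∀ K t, |t| ≤ (cr F θ hP g₀ os).l₀ → ∀ τ ∈ (cr F θ hP g₀ os).T K \ (cr F θ hP g₀ os).Bad K t,
        0 < (cr F θ hP g₀ os).A K t τ - (cr F θ hP g₀ os).shA K t τ ∧ 0 < (cr F θ hP g₀ os).B K t τ - (cr F θ hP g₀ os).shB K t τ) ∧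
      ∃ δ₀ δ₁ : ℕ → ℝ, Summable δ₀ ∧ Summable δ₁ ∧
        (∀ K, ∃ c : ℝ, ∀ t : ℝ, |t| ≤ (cr F θ hP g₀ os).l₀ → ∀ τ ∈ (cr F θ hP g₀ os).T K \ (cr F θ hP g₀ os).Bad K t,
          |Real.log ((cr F θ hP g₀ os).B K 0 τ - (cr F θ hP g₀ os).shB K 0 τ) - Real.log ((cr F θ hP g₀ os).A K 0 τ - (cr F θ hP g₀ os).shA K 0 τ) - c| ≤
            (cr F θ hP g₀ os).vol * δ₀ K) ∧
        (∀ K (t : ℝ), |t| ≤ (cr F θ hP g₀ os).l₀ → ∀ τ ∈ (cr F θ hP g₀ os).T K \ (cr F θ hP g₀ os).Bad K t,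
          |(Real.log ((cr F θ hP g₀ os).B K t τ - (cr F θ hP g₀ os).shB K t τ) - Real.log ((cr F θ hP g₀ os).A K t τ - (cr F θ hP g₀ os).shA K t τ)) -
              (Real.log ((cr F θ hP g₀ os).B K 0 τ - (cr F θ hP g₀ os).shB K 0 τ) - Real.log ((cr F θ hP g₀ os).A K 0 τ - (cr F θ hP g₀ os).shA K 0 τ))| ≤
            (cr F θ hP g₀ os).vol * δ₁ K)) :
    SpineGivenEndpointR13Sep :=
  spineGivenEndpointR13Sep_of_forall_guarded_matchingUnder fun F θ hP hG hθ =>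
    matchingUnder_guarded_datumOfRecord₁₃Sep_of_homes₁₃SepOn_sourceSplit cr 𝔯 (fun F θ => θ.ZtUnity F 2 ∧ θ.SlotsNondegenerate₁₃ F 2)
      h14 h15 h16 h17 h18 h22 h20 h21 hx hread F θ hP hG hθ

/-- **K3⁗ FROM THE STUBS AT THE GUARD-RESTRICTED STAGE-13 (Sep) HOMES AND AN INSERTION-DERIVATIVE READING** [bookkeeping] (`N = 2`; the same with (I) replaced by the agreement of the
two runs' TILTED INSERTION MEANS: at every guarded admissible tuple, given the rates at every run length, `0 < vol`, positive shell-free cores on the good classes, (V) with summable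
`δ⁰`, source-differentiable log-cores on `[−l₀, l₀]` with derivatives `mA`, `mB` and `|mB − mA| ≤ Λ_K` along the source segment of every good class, `0 ≤ Λ` summable ⇒
`SpineGivenEndpointR13Sep`; module 24⁗ `towerEdge₁₃SepOn_of_insertionDerivReading` produces the edge, `matchingUnder_guarded_datumOfRecord₁₃Sep_of_homes₁₃SepOn` consumes it). [folklore] -/
theorem spineGivenEndpointR13Sep_of_homes₁₃SepOn_insertionDeriv
    (h14 : S_N14 (RRec₁₃SepOn 𝔯 fun F θ => θ.ZtUnity F 2 ∧ θ.SlotsNondegenerate₁₃ F 2)) (h15 : S_N15 (RRec₁₃SepOn 𝔯 fun F θ => θ.ZtUnity F 2 ∧ θ.SlotsNondegenerate₁₃ F 2))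
    (h16 : S_N16 (RRec₁₃SepOn 𝔯 fun F θ => θ.ZtUnity F 2 ∧ θ.SlotsNondegenerate₁₃ F 2)) (h17 : S_N17 (RRec₁₃SepOn 𝔯 fun F θ => θ.ZtUnity F 2 ∧ θ.SlotsNondegenerate₁₃ F 2))
    (h18 : S_N18 (RRec₁₃SepOn 𝔯 fun F θ => θ.ZtUnity F 2 ∧ θ.SlotsNondegenerate₁₃ F 2)) (h22 : S_N22 (RRec₁₃SepOn 𝔯 fun F θ => θ.ZtUnity F 2 ∧ θ.SlotsNondegenerate₁₃ F 2))
    (h20 : S_N20 (SRec₁₃SepOn cr fun F θ => θ.ZtUnity F 2 ∧ θ.SlotsNondegenerate₁₃ F 2)) (h21 : S_N21 (SRec₁₃SepOn cr fun F θ => θ.ZtUnity F 2 ∧ θ.SlotsNondegenerate₁₃ F 2))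
    (hx : ∀ (F : T4Family) (θ : Stage13Params F 2) (hP : θ.Provisos₁₃Sep F 2), θ.ZtUnity F 2 ∧ θ.SlotsNondegenerate₁₃ F 2 → θ.Admissible F 2 →
      B16.EndStatementBPrinted (datumOfRecord₁₃Sep F 2 θ hP).C → DagBinding.EndpointExistence (datumOfRecord₁₃Sep F 2 θ hP).C.toB12 →
        T4ContinuumYM4Torus.ForSmallCouplings (datumOfRecord₁₃Sep F 2 θ hP) fun g₀ => ∀ os : List (ULoop F),
          0 < (cr F θ hP g₀ os).l₀ ∧ 0 < (cr F θ hP g₀ os).vol ∧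
          (∀ (K : ℕ) (t : ℝ), |t| ≤ (cr F θ hP g₀ os).l₀ →
            T4GenFunBounds.schemeZ ((datumOfRecord₁₃Sep F 2 θ hP).scheme g₀) os ((cr F θ hP g₀ os).K₀ + K) t =
              ∑ τ ∈ (cr F θ hP g₀ os).T K, (cr F θ hP g₀ os).A K t τ) ∧
          (∀ (K : ℕ) (t : ℝ), |t| ≤ (cr F θ hP g₀ os).l₀ →
            T4GenFunBounds.schemeZ ((datumOfRecord₁₃Sep F 2 θ hP).scheme g₀) os ((cr F θ hP g₀ os).K₀ + K + 1) t =
              ∑ τ ∈ (cr F θ hP g₀ os).T K, (cr F θ hP g₀ os).B K t τ))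
    (hread : ∀ (F : T4Family) (θ : Stage13Params F 2) (hP : θ.Provisos₁₃Sep F 2), θ.ZtUnity F 2 ∧ θ.SlotsNondegenerate₁₃ F 2 → θ.Admissible F 2 →
      ∀ (g₀ : ℕ → ℝ) (os : List (ULoop F)),
      (∀ k : ℕ, RatesAt (datumOfRecord₁₃Sep F 2 θ hP) (rateCarriersOfRecord₁₃Sep 𝔯 F θ hP g₀ os k)) → letI := (cr F θ hP g₀ os).dec
      0 < (cr F θ hP g₀ os).vol ∧
      (∀ K t, |t| ≤ (cr F θ hP g₀ os).l₀ → ∀ τ ∈ (cr F θ hP g₀ os).T K \ (cr F θ hP g₀ os).Bad K t,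
        0 < (cr F θ hP g₀ os).A K t τ - (cr F θ hP g₀ os).shA K t τ ∧ 0 < (cr F θ hP g₀ os).B K t τ - (cr F θ hP g₀ os).shB K t τ) ∧
      ∃ (δ₀ Λ : ℕ → ℝ) (mA mB : ℕ → ℝ → (cr F θ hP g₀ os).ι → ℝ), Summable δ₀ ∧ Summable Λ ∧ (∀ K, 0 ≤ Λ K) ∧
        (∀ K, ∃ c : ℝ, ∀ t : ℝ, |t| ≤ (cr F θ hP g₀ os).l₀ → ∀ τ ∈ (cr F θ hP g₀ os).T K \ (cr F θ hP g₀ os).Bad K t,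
          |Real.log ((cr F θ hP g₀ os).B K 0 τ - (cr F θ hP g₀ os).shB K 0 τ) - Real.log ((cr F θ hP g₀ os).A K 0 τ - (cr F θ hP g₀ os).shA K 0 τ) - c| ≤
            (cr F θ hP g₀ os).vol * δ₀ K) ∧
        (∀ K, ∀ τ ∈ (cr F θ hP g₀ os).T K, ∀ s ∈ Set.Icc (-(cr F θ hP g₀ os).l₀) (cr F θ hP g₀ os).l₀,
          HasDerivWithinAt (fun s => Real.log ((cr F θ hP g₀ os).A K s τ - (cr F θ hP g₀ os).shA K s τ)) (mA K s τ)
            (Set.Icc (-(cr F θ hP g₀ os).l₀) (cr F θ hP g₀ os).l₀) s) ∧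
        (∀ K, ∀ τ ∈ (cr F θ hP g₀ os).T K, ∀ s ∈ Set.Icc (-(cr F θ hP g₀ os).l₀) (cr F θ hP g₀ os).l₀,
          HasDerivWithinAt (fun s => Real.log ((cr F θ hP g₀ os).B K s τ - (cr F θ hP g₀ os).shB K s τ)) (mB K s τ)
            (Set.Icc (-(cr F θ hP g₀ os).l₀) (cr F θ hP g₀ os).l₀) s) ∧
        (∀ K (t : ℝ), |t| ≤ (cr F θ hP g₀ os).l₀ → ∀ τ ∈ (cr F θ hP g₀ os).T K \ (cr F θ hP g₀ os).Bad K t, ∀ s ∈ Set.uIcc (0 : ℝ) t,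
          |mB K s τ - mA K s τ| ≤ Λ K)) :
    SpineGivenEndpointR13Sep :=
  spineGivenEndpointR13Sep_of_forall_guarded_matchingUnder fun F θ hP hG hθ =>
    matchingUnder_guarded_datumOfRecord₁₃Sep_of_homes₁₃SepOn cr 𝔯 (fun F θ => θ.ZtUnity F 2 ∧ θ.SlotsNondegenerate₁₃ F 2) h14 h15 h16 h17 h18 h22 h20 h21 hx
      (towerEdge₁₃SepOn_of_insertionDerivReading cr 𝔯 (fun F θ => θ.ZtUnity F 2 ∧ θ.SlotsNondegenerate₁₃ F 2) hread) F θ hP hG hθ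

end GuardHomes

/-! ## §3 (v1.1, append-only — ⁗) The item from the stubs at the GUARD-restricted Stage-13 (separated-range) homes and a VACUUM-CORE ∕ MGF ∕ TILTED-MATCHING reading (module 24b⁗ by name) -/

section VacuumMGF

open MeasureTheory
open T4OutputRate (Carriers Functional LipBackground NE5 NE9)
open T4TowerRateComposition (PolyLipGrowth)
open T4CauchySum (InjectedRate)
open T4EtaRateMin (Readings NE3Shape)
open T4RateLiaison (GaugeDominated)
open Summit.QuantumFields.BalabanUV.T4Continuum.NE1p.DressedMGFForm (MGFForm TiltedMeanMatching)
open Summit.QuantumFields.YangMills.BalabanUVNodes.N19LedgerLinkSync (LedgerDataSync)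
open Summit.QuantumFields.YangMills.BalabanUVNodes.N19LedgerPieces (TwoRunFormat LedgerBooking LedgerOtherKinds LedgerSize LedgerConventions)
open Summit.QuantumFields.YangMills.BalabanUVNodes.N19TargetAtHomes13SepOnVacuumMGF (matchingUnder_guarded_datumOfRecord₁₃Sep_of_homes₁₃SepOn_vacuumMGF
  matchingUnder_guarded_datumOfRecord₁₃Sep_of_homes₁₃SepOn_vacuumLedgerPiecesMGF)

variable (cr : SpineReading₁₃Sep 2) (𝔯 : RateReading₁₃Sep 2)

/-- **K3⁗ FROM THE STUBS AT THE GUARD-RESTRICTED STAGE-13 (Sep) HOMES AND A VACUUM-CORE ∕ MGF ∕ TILTED-MATCHING READING** [bookkeeping] (`N = 2`, regime = the item's guard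
`θ.ZtUnity F 2 ∧ θ.SlotsNondegenerate₁₃ F 2`; §2's `spineGivenEndpointR13Sep_of_homes₁₃SepOn_sourceSplit` with the source-split reading replaced): the six in-edges BY NAME at `RRec₁₃SepOn 𝔯 Rg`,
`S_N20` ∕ `S_N21` at `SRec₁₃SepOn cr Rg`, the guarded keyed extraction clause, and — at every guarded admissible tuple, given the rates at every run length of `𝔯` — `0 < vol`, the VACUUM
shell-free cores' `NE7.Core` with summable `δ⁰`, MGF forms of both DRESSED shell-free cores, and N14's `TiltedMeanMatching η` with `Summable η` ⇒ `SpineGivenEndpointR13Sep` (module 24b⁗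
`matchingUnder_guarded_datumOfRecord₁₃Sep_of_homes₁₃SepOn_vacuumMGF` ∘ `spineGivenEndpointR13Sep_of_forall_guarded_matchingUnder`).  Every input a HYPOTHESIS; (I) is N14's NE1′ residual, (V) any
N19 knit on the vacuum cores; NOT NE7; the item is NOT claimed. [folklore] -/
theorem spineGivenEndpointR13Sep_of_homes₁₃SepOn_vacuumMGF
    (h14 : S_N14 (RRec₁₃SepOn 𝔯 fun F θ => θ.ZtUnity F 2 ∧ θ.SlotsNondegenerate₁₃ F 2)) (h15 : S_N15 (RRec₁₃SepOn 𝔯 fun F θ => θ.ZtUnity F 2 ∧ θ.SlotsNondegenerate₁₃ F 2))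
    (h16 : S_N16 (RRec₁₃SepOn 𝔯 fun F θ => θ.ZtUnity F 2 ∧ θ.SlotsNondegenerate₁₃ F 2)) (h17 : S_N17 (RRec₁₃SepOn 𝔯 fun F θ => θ.ZtUnity F 2 ∧ θ.SlotsNondegenerate₁₃ F 2))
    (h18 : S_N18 (RRec₁₃SepOn 𝔯 fun F θ => θ.ZtUnity F 2 ∧ θ.SlotsNondegenerate₁₃ F 2)) (h22 : S_N22 (RRec₁₃SepOn 𝔯 fun F θ => θ.ZtUnity F 2 ∧ θ.SlotsNondegenerate₁₃ F 2))
    (h20 : S_N20 (SRec₁₃SepOn cr fun F θ => θ.ZtUnity F 2 ∧ θ.SlotsNondegenerate₁₃ F 2)) (h21 : S_N21 (SRec₁₃SepOn cr fun F θ => θ.ZtUnity F 2 ∧ θ.SlotsNondegenerate₁₃ F 2))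
    (hx : ∀ (F : T4Family) (θ : Stage13Params F 2) (hP : θ.Provisos₁₃Sep F 2), θ.ZtUnity F 2 ∧ θ.SlotsNondegenerate₁₃ F 2 → θ.Admissible F 2 →
      B16.EndStatementBPrinted (datumOfRecord₁₃Sep F 2 θ hP).C → DagBinding.EndpointExistence (datumOfRecord₁₃Sep F 2 θ hP).C.toB12 →
        T4ContinuumYM4Torus.ForSmallCouplings (datumOfRecord₁₃Sep F 2 θ hP) fun g₀ => ∀ os : List (ULoop F),
          0 < (cr F θ hP g₀ os).l₀ ∧ 0 < (cr F θ hP g₀ os).vol ∧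
          (∀ (K : ℕ) (t : ℝ), |t| ≤ (cr F θ hP g₀ os).l₀ →
            T4GenFunBounds.schemeZ ((datumOfRecord₁₃Sep F 2 θ hP).scheme g₀) os ((cr F θ hP g₀ os).K₀ + K) t =
              ∑ τ ∈ (cr F θ hP g₀ os).T K, (cr F θ hP g₀ os).A K t τ) ∧
          (∀ (K : ℕ) (t : ℝ), |t| ≤ (cr F θ hP g₀ os).l₀ →
            T4GenFunBounds.schemeZ ((datumOfRecord₁₃Sep F 2 θ hP).scheme g₀) os ((cr F θ hP g₀ os).K₀ + K + 1) t =
              ∑ τ ∈ (cr F θ hP g₀ os).T K, (cr F θ hP g₀ os).B K t τ))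
    (hread : ∀ (F : T4Family) (θ : Stage13Params F 2) (hP : θ.Provisos₁₃Sep F 2), θ.ZtUnity F 2 ∧ θ.SlotsNondegenerate₁₃ F 2 → θ.Admissible F 2 →
      ∀ (g₀ : ℕ → ℝ) (os : List (ULoop F)),
      (∀ k : ℕ, RatesAt (datumOfRecord₁₃Sep F 2 θ hP) (rateCarriersOfRecord₁₃Sep 𝔯 F θ hP g₀ os k)) → letI := (cr F θ hP g₀ os).dec
      0 < (cr F θ hP g₀ os).vol ∧
      ∃ (δ₀ η : ℕ → ℝ) (Ω Ω' : ℕ → Type) (_ : ∀ K, MeasurableSpace (Ω K)) (_ : ∀ K, MeasurableSpace (Ω' K)) (Bo : ℝ)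
        (Fo : ∀ K, Ω K → ℝ) (ν : ∀ K, (cr F θ hP g₀ os).ι → Measure (Ω K)) (Fo' : ∀ K, Ω' K → ℝ) (ν' : ∀ K, (cr F θ hP g₀ os).ι → Measure (Ω' K)),
        NE7.Core (cr F θ hP g₀ os).l₀ (cr F θ hP g₀ os).vol (cr F θ hP g₀ os).T (cr F θ hP g₀ os).Bad
          (fun K _ τ => (cr F θ hP g₀ os).A K 0 τ - (cr F θ hP g₀ os).shA K 0 τ) (fun K _ τ => (cr F θ hP g₀ os).B K 0 τ - (cr F θ hP g₀ os).shB K 0 τ) δ₀ ∧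
        Summable δ₀ ∧
        MGFForm Bo (cr F θ hP g₀ os).T Fo ν (fun K t τ => (cr F θ hP g₀ os).A K t τ - (cr F θ hP g₀ os).shA K t τ) ∧
        MGFForm Bo (cr F θ hP g₀ os).T Fo' ν' (fun K t τ => (cr F θ hP g₀ os).B K t τ - (cr F θ hP g₀ os).shB K t τ) ∧
        TiltedMeanMatching (cr F θ hP g₀ os).l₀ (cr F θ hP g₀ os).T (cr F θ hP g₀ os).Bad Fo ν Fo' ν' η ∧ Summable η) :
    SpineGivenEndpointR13Sep :=
  spineGivenEndpointR13Sep_of_forall_guarded_matchingUnder fun F θ hP hG hθ =>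
    matchingUnder_guarded_datumOfRecord₁₃Sep_of_homes₁₃SepOn_vacuumMGF cr 𝔯 (fun F θ => θ.ZtUnity F 2 ∧ θ.SlotsNondegenerate₁₃ F 2)
      h14 h15 h16 h17 h18 h22 h20 h21 hx hread F θ hP hG hθ

/-- **K3⁗ FROM THE STUBS AT THE GUARD-RESTRICTED STAGE-13 (Sep) HOMES AND NODE O's VACUUM LEDGER PIECES** [bookkeeping] (`N = 2`; the same with the vacuum `Core` PRODUCED by the
ledger road at the pieces of record): at every guarded admissible tuple, given the rates, `0 < vol` and ledger data `L`, readings `R` and letters with F1 `TwoRunFormat` · F2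
`LedgerBooking` · F3 `LedgerOtherKinds` · S `LedgerSize` · C `LedgerConventions` ON THE VACUUM shell-free cores of `cr F θ hP g₀ os`, the remaining kinds in SPECIES FORM (one-run
first-step bound, constants' deviation datum — F3′ no longer a hypothesis), the in-edge letters (N16 `NE3Shape` + `GaugeDominated`, N18 `NE5`, N22 `NE9 ∧ FadingMemory`, N17∕U2
`InjectedRate`, box, (T) `LipBackground` + `PolyLipGrowth`, window), MGF forms of both dressed shell-free cores and N14's `TiltedMeanMatching η` with `Summable η` ⇒
`SpineGivenEndpointR13Sep` (module 24b⁗ `matchingUnder_guarded_datumOfRecord₁₃Sep_of_homes₁₃SepOn_vacuumLedgerPiecesMGF` ∘ `spineGivenEndpointR13Sep_of_forall_guarded_matchingUnder`).  What NODE O's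
vacuum instance at the Stage-13 (separated-range) tuples must hand, BY NAME, with NO observable and NO unprinted estimate inside N19.  Every input a HYPOTHESIS; the item is NOT claimed. [folklore] -/
theorem spineGivenEndpointR13Sep_of_homes₁₃SepOn_vacuumLedgerPiecesMGF
    (h14 : S_N14 (RRec₁₃SepOn 𝔯 fun F θ => θ.ZtUnity F 2 ∧ θ.SlotsNondegenerate₁₃ F 2)) (h15 : S_N15 (RRec₁₃SepOn 𝔯 fun F θ => θ.ZtUnity F 2 ∧ θ.SlotsNondegenerate₁₃ F 2))
    (h16 : S_N16 (RRec₁₃SepOn 𝔯 fun F θ => θ.ZtUnity F 2 ∧ θ.SlotsNondegenerate₁₃ F 2)) (h17 : S_N17 (RRec₁₃SepOn 𝔯 fun F θ => θ.ZtUnity F 2 ∧ θ.SlotsNondegenerate₁₃ F 2))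
    (h18 : S_N18 (RRec₁₃SepOn 𝔯 fun F θ => θ.ZtUnity F 2 ∧ θ.SlotsNondegenerate₁₃ F 2)) (h22 : S_N22 (RRec₁₃SepOn 𝔯 fun F θ => θ.ZtUnity F 2 ∧ θ.SlotsNondegenerate₁₃ F 2))
    (h20 : S_N20 (SRec₁₃SepOn cr fun F θ => θ.ZtUnity F 2 ∧ θ.SlotsNondegenerate₁₃ F 2)) (h21 : S_N21 (SRec₁₃SepOn cr fun F θ => θ.ZtUnity F 2 ∧ θ.SlotsNondegenerate₁₃ F 2))
    (hx : ∀ (F : T4Family) (θ : Stage13Params F 2) (hP : θ.Provisos₁₃Sep F 2), θ.ZtUnity F 2 ∧ θ.SlotsNondegenerate₁₃ F 2 → θ.Admissible F 2 →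
      B16.EndStatementBPrinted (datumOfRecord₁₃Sep F 2 θ hP).C → DagBinding.EndpointExistence (datumOfRecord₁₃Sep F 2 θ hP).C.toB12 →
        T4ContinuumYM4Torus.ForSmallCouplings (datumOfRecord₁₃Sep F 2 θ hP) fun g₀ => ∀ os : List (ULoop F),
          0 < (cr F θ hP g₀ os).l₀ ∧ 0 < (cr F θ hP g₀ os).vol ∧
          (∀ (K : ℕ) (t : ℝ), |t| ≤ (cr F θ hP g₀ os).l₀ →
            T4GenFunBounds.schemeZ ((datumOfRecord₁₃Sep F 2 θ hP).scheme g₀) os ((cr F θ hP g₀ os).K₀ + K) t =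
              ∑ τ ∈ (cr F θ hP g₀ os).T K, (cr F θ hP g₀ os).A K t τ) ∧
          (∀ (K : ℕ) (t : ℝ), |t| ≤ (cr F θ hP g₀ os).l₀ →
            T4GenFunBounds.schemeZ ((datumOfRecord₁₃Sep F 2 θ hP).scheme g₀) os ((cr F θ hP g₀ os).K₀ + K + 1) t =
              ∑ τ ∈ (cr F θ hP g₀ os).T K, (cr F θ hP g₀ os).B K t τ))
    (hread : ∀ (F : T4Family) (θ : Stage13Params F 2) (hP : θ.Provisos₁₃Sep F 2), θ.ZtUnity F 2 ∧ θ.SlotsNondegenerate₁₃ F 2 → θ.Admissible F 2 →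
      ∀ (g₀ : ℕ → ℝ) (os : List (ULoop F)),
      (∀ k : ℕ, RatesAt (datumOfRecord₁₃Sep F 2 θ hP) (rateCarriersOfRecord₁₃Sep 𝔯 F θ hP g₀ os k)) → letI := (cr F θ hP g₀ os).dec
      0 < (cr F θ hP g₀ os).vol ∧
      ∃ (C : Carriers) (_ : DecidableEq C.Dom) (F' : Type) (ι' X' : Type) (_ : MeasurableSpace ι')
        (L : LedgerDataSync C F' ι' (cr F θ hP g₀ os).ι) (R : Readings ι' X') (W : Set (ℕ → ℝ)) (EA : Functional C C.BgA)
        (EB : Functional C C.BgB) (κ θ₅ C₅ C₉ ω θc Cd γ C₃ θ₃ Pg : ℝ) (q : ℕ) (Λm : ℕ → ℕ → ℝ)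
        (CU : (ℕ → ℝ) → ℕ → ℝ) (g : ℕ → ℕ → ℝ) (uA : ℕ → ι' → C.BgA) (uB : ℕ → ι' → C.BgB)
        (Φ : ℕ → ℝ → (cr F θ hP g₀ os).ι → ι' → ℝ) (e ρ : ℕ → ℝ) (α β : ℕ → ℝ → (cr F θ hP g₀ os).ι → ℝ)
        (η : ℕ → ℝ) (Ω Ω' : ℕ → Type) (_ : ∀ K, MeasurableSpace (Ω K)) (_ : ∀ K, MeasurableSpace (Ω' K)) (Bo : ℝ)
        (Fo : ∀ K, Ω K → ℝ) (ν : ∀ K, (cr F θ hP g₀ os).ι → Measure (Ω K)) (Fo' : ∀ K, Ω' K → ℝ) (ν' : ∀ K, (cr F θ hP g₀ os).ι → Measure (Ω' K)),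
        (TwoRunFormat L (cr F θ hP g₀ os).l₀ (cr F θ hP g₀ os).T (cr F θ hP g₀ os).Bad
            (fun K _ τ => (cr F θ hP g₀ os).A K 0 τ - (cr F θ hP g₀ os).shA K 0 τ) (fun K _ τ => (cr F θ hP g₀ os).B K 0 τ - (cr F θ hP g₀ os).shB K 0 τ) R EA EB g uA uB ∧
          LedgerBooking L (cr F θ hP g₀ os).l₀ (cr F θ hP g₀ os).vol (cr F θ hP g₀ os).T (cr F θ hP g₀ os).Bad κ ∧
          LedgerOtherKinds L (cr F θ hP g₀ os).l₀ (cr F θ hP g₀ os).vol (cr F θ hP g₀ os).T (cr F θ hP g₀ os).Bad R EA EB g ∧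
          LedgerSize L (cr F θ hP g₀ os).l₀ (cr F θ hP g₀ os).vol (cr F θ hP g₀ os).T (cr F θ hP g₀ os).Bad R EA EB g uA uB ∧
          LedgerConventions L (cr F θ hP g₀ os).vol R ω θc θ₅ θ₃) ∧
        ((∀ K t τ v, L.oA'' K t τ v = Real.exp (α K t τ)) ∧
          (∀ K t τ v, L.oB'' K t τ v = Real.exp (Φ K t τ v + e K) * Real.exp (β K t τ)) ∧
          (∀ K t τ, L.cO'' K t τ = e K + (β K t τ - α K t τ)) ∧ (∀ K t τ, L.RO'' K t τ = (cr F θ hP g₀ os).vol * ρ K) ∧ L.rO'' = ρ ∧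
          (∀ K t, |t| ≤ (cr F θ hP g₀ os).l₀ → ∀ τ ∈ (cr F θ hP g₀ os).T K \ (cr F θ hP g₀ os).Bad K t, ∀ v ∈ R.dom,
            |Φ K t τ v| ≤ (cr F θ hP g₀ os).vol * ρ K) ∧ Summable ρ ∧
          (∃ b₀ s : ℕ → ℝ, Summable s ∧ ∀ K t, |t| ≤ (cr F θ hP g₀ os).l₀ → ∀ τ ∈ (cr F θ hP g₀ os).T K \ (cr F θ hP g₀ os).Bad K t,
            |β K t τ - α K t τ - b₀ K| ≤ (cr F θ hP g₀ os).vol * s K)) ∧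
        (NE3Shape R C₃ θ₃ ∧ 0 ≤ C₃ ∧ GaugeDominated R uA uB ∧
          NE5 EA EB W κ θ₅ C₅ ∧ 0 ≤ θ₅ ∧ 0 ≤ C₅ ∧
          (NE9 EA W κ Λm ∧ T4OutputRate.FadingMemory C₉ ω Λm) ∧ 0 ≤ ω ∧
          InjectedRate Cd 0 θc (fun K j => T4CouplingMatching.disc (g K) (g (K + 1)) j) ∧ 0 ≤ Cd ∧ 0 ≤ θc ∧
          (∀ K i, i ≤ K → 0 < g K i ∧ g K i ≤ γ) ∧
          LipBackground EA W κ CU ∧ PolyLipGrowth CU g Pg q ∧ 0 ≤ Pg ∧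
          (∀ K, g K ∈ W) ∧ (∀ K, (fun i => g (K + 1) (i + 1)) ∈ W)) ∧
        (MGFForm Bo (cr F θ hP g₀ os).T Fo ν (fun K t τ => (cr F θ hP g₀ os).A K t τ - (cr F θ hP g₀ os).shA K t τ) ∧
          MGFForm Bo (cr F θ hP g₀ os).T Fo' ν' (fun K t τ => (cr F θ hP g₀ os).B K t τ - (cr F θ hP g₀ os).shB K t τ) ∧
          TiltedMeanMatching (cr F θ hP g₀ os).l₀ (cr F θ hP g₀ os).T (cr F θ hP g₀ os).Bad Fo ν Fo' ν' η ∧ Summable η)) :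
    SpineGivenEndpointR13Sep :=
  spineGivenEndpointR13Sep_of_forall_guarded_matchingUnder fun F θ hP hG hθ =>
    matchingUnder_guarded_datumOfRecord₁₃Sep_of_homes₁₃SepOn_vacuumLedgerPiecesMGF cr 𝔯 (fun F θ => θ.ZtUnity F 2 ∧ θ.SlotsNondegenerate₁₃ F 2)
      h14 h15 h16 h17 h18 h22 h20 h21 hx hread F θ hP hG hθ

end VacuumMGF

end Summit.QuantumFields.YangMills.BalabanUVNodes.N19TargetK3R13SepReading
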